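import Summits.Ventures.HodgeRepro2.T5SU11KernelAnalytic
import Summits.Ventures.HodgeRepro2.T5SU11ResolventIterateKernel
import Summits.Ventures.HodgeRepro2.T5SU11KernelCompositionIteratedDerivative
import Summits.Ventures.HodgeRepro2.T5SU11ResolventNeumannUniform

/-!
# Summary XXII — the composed kernels: symmetry, the powers of the resolvent, Chapman–Kolmogorov, iterated derivatives,
analyticity in the spectral parameter, uniform convergence of the Neumann series (rows 582–587), under uniform names

Throughout `μ = λ(λ − 2)`, `λ(μ) = 1 + √(μ + 1)`, `K_λ` the kernel of `G^I_λ`, `K_λ^{∘(n+1)}(t, s) = (G^I_λ)ⁿ K_λ(·, s)(t)`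
the composed kernels, `⟨f, h⟩ = ∫ f h sinh 2r dr`, the class = continuous sources bounded near `0` and decaying at a
rate `> 1`, `W_1 = {|g| ≤ D Ξ}`.

* `kernel_comp_symmetric` — **`K_λ^{∘(n+1)}(t, s) = K_λ^{∘(n+1)}(s, t)`** (row 582);
* `iterate_symm`, `iterate_inner_add`, `iterate_self_adjoint` — **`⟨f, Gⁿ h⟩ = ⟨Gⁿ f, h⟩`, `⟨Gᵐ f, Gⁿ h⟩ = ⟨G^{m+n} f, h⟩ = ⟨Gⁿ f, Gᵐ h⟩`**
  on the class (row 583);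
* `iterate_eq_integral_kernel_comp`, `kernel_chapman_kolmogorov` — **`G^{n+1} g(t) = ∫ K^{∘(n+1)}(t, r) g(r) sinh 2r dr`** on the
  class, **`K^{∘(m+n+2)}(t, s) = ∫ K^{∘(m+1)}(t, r) K^{∘(n+1)}(r, s) sinh 2r dr`** (row 585);
* `kernel_comp_iteratedDeriv_mu`, `kernel_comp_iteratedDeriv_mu'` — **`∂ᵏ_μ K_μ^{∘(n+1)} = (n+1)⋯(n+k) K_μ^{∘(n+k+1)}`** (row 586);
* `kernel_power_series`, `kernel_analytic_mu`, `kernel_analyticOnNhd`, `kernel_analytic_lam`, `resolvent_power_series`,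
  `resolvent_analytic_mu`, `resolvent_analyticOnNhd`, `resolvent_analytic_lam` — **the kernel and the `W_1`-resolvent are
  real-analytic in `μ` on `(−1, ∞)` and in `λ` on `(1, ∞)`**, with the explicit power series of radius `(λ₂ − 1)²` (row 584);
* `neumann_remainder`, `neumann_remainder_uniform`, `neumann_tendstoUniformlyOn` — **the exact remainder of the Neumann
  series on `W_1` and its uniform convergence on `(0, ∞)`** (row 587).

Nothing is claimed about (N).

Blind lane: Mathlib + the HodgeRepro2 prefix only; no sorry; axioms ⊆ {propext, Classical.choice,
Quot.sound}.
-/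

namespace Summit.Ventures.HodgeRepro2.T5SU11RadialSummaryXXII

open Filter Topology MeasureTheory
open Set (Ioi Ioc)
open T5SU11Cartan T5SU11SphericalFunction T5SU11SphericalDecay T5SU11RadialGreenKernel T5SU11RadialGreenImproper
  T5SU11KernelCompositionSymmetric T5SU11ResolventIterateSymmetric T5SU11KernelAnalytic T5SU11ResolventIterateKernel
  T5SU11KernelCompositionIteratedDerivative T5SU11ResolventNeumannUniform

section measure

variable [MeasurableSpace Circle] [BorelSpace Circle]

section kernels

variable {lam : ℝ} (hlam : 1 < lam)

include hlam in
/-- **The composed kernels are symmetric** (row 582). -/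
theorem kernel_comp_symmetric (n : ℕ) {t s : ℝ} (ht : 0 < t) (hs : 0 < s) :
    ((greenSolI (fun t => sph lam (hyp t)) (sphDecay lam))^[n] (fun r => sphGreenKernel lam r s)) t
      = ((greenSolI (fun t => sph lam (hyp t)) (sphDecay lam))^[n] (fun r => sphGreenKernel lam r t)) s :=
  kernel_comp_symm hlam n ht hs

include hlam in
/-- **Chapman–Kolmogorov for the composed kernels** (row 585). -/
theorem kernel_chapman_kolmogorov (m n : ℕ) {t s : ℝ} (ht : 0 < t) (hs : 0 < s) :
    ((greenSolI (fun t => sph lam (hyp t)) (sphDecay lam))^[m + n + 1] (fun r => sphGreenKernel lam r s)) t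
      = ∫ r in Ioi 0, ((greenSolI (fun t => sph lam (hyp t)) (sphDecay lam))^[m] (fun u => sphGreenKernel lam u r)) t
          * ((greenSolI (fun t => sph lam (hyp t)) (sphDecay lam))^[n] (fun r => sphGreenKernel lam r s)) r
          * Real.sinh (2 * r) :=
  kernel_comp_add hlam m n ht hs

end kernels

section class_sources

variable {lam : ℝ} (hlam : 1 < lam)
  {f : ℝ → ℝ} (hf : ContinuousOn f (Ioi 0))
  {M : ℝ} (hM : ∀ r ∈ Ioc (0 : ℝ) 1, |f r| ≤ M) (hM0 : 0 ≤ M)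
  {ε C s₀ : ℝ} (hε : 2 - lam < ε) (hε1 : 1 < ε) (hC : ∀ r, s₀ ≤ r → |f r| ≤ C * Real.exp (-ε * r))
  {h : ℝ → ℝ} (hh : ContinuousOn h (Ioi 0))
  {M' : ℝ} (hM' : ∀ s ∈ Ioc (0 : ℝ) 1, |h s| ≤ M') (hM'0 : 0 ≤ M')
  {ε' C' s₀' : ℝ} (hε' : 2 - lam < ε') (hε'1 : 1 < ε') (hC' : ∀ s, s₀' ≤ s → |h s| ≤ C' * Real.exp (-ε' * s))

include hlam hf hM hM0 hε hε1 hC hh hM' hM'0 hε' hε'1 hC' in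
/-- **The powers of the resolvent are symmetric on the class**: `⟨f, Gⁿ h⟩ = ⟨Gⁿ f, h⟩` (row 583). -/
theorem iterate_symm (n : ℕ) :
    ∫ r in Ioi 0, f r * ((greenSolI (fun t => sph lam (hyp t)) (sphDecay lam))^[n] h) r * Real.sinh (2 * r)
      = ∫ r in Ioi 0, ((greenSolI (fun t => sph lam (hyp t)) (sphDecay lam))^[n] f) r * h r * Real.sinh (2 * r) :=
  inner_iterate_symm hlam hh hM' hM'0 hε' hε'1 hC' n f M ε C s₀ hf hM hM0 hε hε1 hC

include hlam hf hM hM0 hε hε1 hC hh hM' hM'0 hε' hε'1 hC' in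
/-- **`⟨Gᵐ f, Gⁿ h⟩ = ⟨G^{m+n} f, h⟩`** on the class (row 583). -/
theorem iterate_inner_add (m n : ℕ) :
    ∫ r in Ioi 0, ((greenSolI (fun t => sph lam (hyp t)) (sphDecay lam))^[m] f) r
        * ((greenSolI (fun t => sph lam (hyp t)) (sphDecay lam))^[n] h) r * Real.sinh (2 * r)
      = ∫ r in Ioi 0, ((greenSolI (fun t => sph lam (hyp t)) (sphDecay lam))^[n + m] f) r * h r
          * Real.sinh (2 * r) :=
  inner_iterate_iterate hlam hh hM' hM'0 hε' hε'1 hC' hf hM hM0 hε hε1 hC m n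

include hlam hf hM hM0 hε hε1 hC hh hM' hM'0 hε' hε'1 hC' in
/-- **The powers of the resolvent are self-adjoint on the class**: `⟨Gᵐ f, Gⁿ h⟩ = ⟨Gⁿ f, Gᵐ h⟩` (row 583). -/
theorem iterate_self_adjoint (m n : ℕ) :
    ∫ r in Ioi 0, ((greenSolI (fun t => sph lam (hyp t)) (sphDecay lam))^[m] f) r
        * ((greenSolI (fun t => sph lam (hyp t)) (sphDecay lam))^[n] h) r * Real.sinh (2 * r)
      = ∫ r in Ioi 0, ((greenSolI (fun t => sph lam (hyp t)) (sphDecay lam))^[n] f) r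
          * ((greenSolI (fun t => sph lam (hyp t)) (sphDecay lam))^[m] h) r * Real.sinh (2 * r) :=
  inner_iterate_comm hlam hh hM' hM'0 hε' hε'1 hC' hf hM hM0 hε hε1 hC m n

omit hh hM' hM'0 hε' hε'1 hC' in
include hlam hf hM hM0 hε hε1 hC in
/-- **The powers of the resolvent are the integral operators of the composed kernels** on the class (row 585). -/
theorem iterate_eq_integral_kernel_comp (n : ℕ) {t : ℝ} (ht : 0 < t) :
    ((greenSolI (fun t => sph lam (hyp t)) (sphDecay lam))^[n + 1] f) t
      = ∫ r in Ioi 0, ((greenSolI (fun t => sph lam (hyp t)) (sphDecay lam))^[n] (fun u => sphGreenKernel lam u r)) t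
          * f r * Real.sinh (2 * r) :=
  iterate_succ_eq_integral hlam hf hM hM0 hε hε1 hC n ht

end class_sources

section spectral

variable {s : ℝ} (hs : 0 < s)

include hs in
/-- **The iterated derivatives of the composed kernels** `∂ᵏ_μ K_μ^{∘(n+1)} = (n+1)⋯(n+k) K_μ^{∘(n+k+1)}` (row 586). -/
theorem kernel_comp_iteratedDeriv_mu (k n : ℕ) {μ₂ : ℝ} (hμ₂ : -1 < μ₂) {t : ℝ} (ht : 0 < t) :
    iteratedDeriv k (fun μ => ((greenSolI (fun t => sph (1 + Real.sqrt (μ + 1)) (hyp t))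
        (sphDecay (1 + Real.sqrt (μ + 1))))^[n] (fun r => sphGreenKernel (1 + Real.sqrt (μ + 1)) r s)) t) μ₂
      = ((n + k).descFactorial k : ℝ) * ((greenSolI (fun t => sph (1 + Real.sqrt (μ₂ + 1)) (hyp t))
        (sphDecay (1 + Real.sqrt (μ₂ + 1))))^[n + k] (fun r => sphGreenKernel (1 + Real.sqrt (μ₂ + 1)) r s)) t :=
  iteratedDeriv_kernel_comp_mu hs k n hμ₂ ht

include hs in
/-- The iterated derivatives of the composed kernels at `μ₂ = λ₂(λ₂ − 2)` (row 586). -/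
theorem kernel_comp_iteratedDeriv_mu' (k n : ℕ) {lam₂ : ℝ} (hlam₂ : 1 < lam₂) {t : ℝ} (ht : 0 < t) :
    iteratedDeriv k (fun μ => ((greenSolI (fun t => sph (1 + Real.sqrt (μ + 1)) (hyp t))
        (sphDecay (1 + Real.sqrt (μ + 1))))^[n] (fun r => sphGreenKernel (1 + Real.sqrt (μ + 1)) r s)) t)
        (lam₂ * (lam₂ - 2))
      = ((n + k).descFactorial k : ℝ) * ((greenSolI (fun t => sph lam₂ (hyp t)) (sphDecay lam₂))^[n + k]
        (fun r => sphGreenKernel lam₂ r s)) t :=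
  iteratedDeriv_kernel_comp_mu' hs k n hlam₂ ht

include hs in
/-- **The kernel's power series in `μ`** of radius `(λ₂ − 1)²` about `μ₂ = λ₂(λ₂ − 2)` (row 584). -/
theorem kernel_power_series {lam₂ : ℝ} (hlam₂ : 1 < lam₂) {t : ℝ} (ht : 0 < t) :
    HasFPowerSeriesOnBall (fun μ => sphGreenKernel (1 + Real.sqrt (μ + 1)) t s)
      (FormalMultilinearSeries.ofScalars ℝ
        (fun k => ((greenSolI (fun t => sph lam₂ (hyp t)) (sphDecay lam₂))^[k] (fun r => sphGreenKernel lam₂ r s)) t))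
      (lam₂ * (lam₂ - 2)) (ENNReal.ofReal ((lam₂ - 1) ^ 2)) :=
  kernel_hasFPowerSeriesOnBall hlam₂ hs ht

include hs in
/-- **The kernel is real-analytic in `μ`** at every `μ₂ > −1` (row 584). -/
theorem kernel_analytic_mu {μ₂ : ℝ} (hμ₂ : -1 < μ₂) {t : ℝ} (ht : 0 < t) :
    AnalyticAt ℝ (fun μ => sphGreenKernel (1 + Real.sqrt (μ + 1)) t s) μ₂ :=
  kernel_analyticAt_mu hs hμ₂ ht

include hs in
/-- **The kernel is real-analytic in `μ` on `(−1, ∞)`** (row 584). -/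
theorem kernel_analyticOnNhd {t : ℝ} (ht : 0 < t) :
    AnalyticOnNhd ℝ (fun μ => sphGreenKernel (1 + Real.sqrt (μ + 1)) t s) (Ioi (-1)) :=
  kernel_analyticOnNhd_mu hs ht

include hs in
/-- **The kernel is real-analytic in `λ`** at every `λ₂ > 1` (row 584). -/
theorem kernel_analytic_lam {lam₂ : ℝ} (hlam₂ : 1 < lam₂) {t : ℝ} (ht : 0 < t) :
    AnalyticAt ℝ (fun lam => sphGreenKernel lam t s) lam₂ :=
  kernel_analyticAt_lam hs hlam₂ ht

end spectral

section ground_state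

variable {lam lam₂ : ℝ} (hlam : 1 < lam) (hlam₂ : 1 < lam₂) {g : ℝ → ℝ} (hg : ContinuousOn g (Ioi 0))
  {D : ℝ} (hD : ∀ s, 0 < s → |g s| ≤ D * sph 1 (hyp s))

omit hlam in
include hlam₂ hg hD in
/-- **The `W_1`-resolvent's power series in `μ`** of radius `(λ₂ − 1)²` about `μ₂ = λ₂(λ₂ − 2)` (row 584). -/
theorem resolvent_power_series {t : ℝ} (ht : 0 < t) :
    HasFPowerSeriesOnBall
      (fun μ => greenSolI (fun t => sph (1 + Real.sqrt (μ + 1)) (hyp t)) (sphDecay (1 + Real.sqrt (μ + 1))) g t)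
      (FormalMultilinearSeries.ofScalars ℝ
        (fun k => ((greenSolI (fun t => sph lam₂ (hyp t)) (sphDecay lam₂))^[k + 1] g) t))
      (lam₂ * (lam₂ - 2)) (ENNReal.ofReal ((lam₂ - 1) ^ 2)) :=
  resolvent_hasFPowerSeriesOnBall hlam₂ hg hD ht

omit hlam hlam₂ in
include hg hD in
/-- **The `W_1`-resolvent is real-analytic in `μ`** at every `μ₂ > −1` (row 584). -/
theorem resolvent_analytic_mu {μ₂ : ℝ} (hμ₂ : -1 < μ₂) {t : ℝ} (ht : 0 < t) :
    AnalyticAt ℝ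
      (fun μ => greenSolI (fun t => sph (1 + Real.sqrt (μ + 1)) (hyp t)) (sphDecay (1 + Real.sqrt (μ + 1))) g t) μ₂ :=
  resolvent_analyticAt_mu hg hD hμ₂ ht

omit hlam hlam₂ in
include hg hD in
/-- **The `W_1`-resolvent is real-analytic in `μ` on `(−1, ∞)`** (row 584). -/
theorem resolvent_analyticOnNhd {t : ℝ} (ht : 0 < t) :
    AnalyticOnNhd ℝ
      (fun μ => greenSolI (fun t => sph (1 + Real.sqrt (μ + 1)) (hyp t)) (sphDecay (1 + Real.sqrt (μ + 1))) g t)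
      (Ioi (-1)) :=
  resolvent_analyticOnNhd_mu hg hD ht

omit hlam in
include hlam₂ hg hD in
/-- **The `W_1`-resolvent is real-analytic in `λ`** at every `λ₂ > 1` (row 584). -/
theorem resolvent_analytic_lam {t : ℝ} (ht : 0 < t) :
    AnalyticAt ℝ (fun lam => greenSolI (fun t => sph lam (hyp t)) (sphDecay lam) g t) lam₂ :=
  resolvent_analyticAt_lam hg hD hlam₂ ht

include hlam hlam₂ hg hD in
/-- **The exact remainder of the Neumann series on `W_1`** (row 587). -/
theorem neumann_remainder (n : ℕ) {t : ℝ} (ht : 0 < t) :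
    |greenSolI (fun t => sph lam (hyp t)) (sphDecay lam) g t
        - ∑ k ∈ Finset.range (n + 1), (lam * (lam - 2) - lam₂ * (lam₂ - 2)) ^ k
            * (greenSolI (fun t => sph lam₂ (hyp t)) (sphDecay lam₂))^[k + 1] g t|
      ≤ D * sph 1 (hyp t) / (lam - 1) ^ 2
          * (|lam * (lam - 2) - lam₂ * (lam₂ - 2)| / (lam₂ - 1) ^ 2) ^ (n + 1) :=
  neumann_remainder_le hlam hlam₂ hg hD n ht

include hlam hlam₂ hg hD in
/-- **The `t`-uniform remainder of the Neumann series on `W_1`** (row 587). -/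
theorem neumann_remainder_uniform (n : ℕ) {t : ℝ} (ht : 0 < t) :
    |greenSolI (fun t => sph lam (hyp t)) (sphDecay lam) g t
        - ∑ k ∈ Finset.range (n + 1), (lam * (lam - 2) - lam₂ * (lam₂ - 2)) ^ k
            * (greenSolI (fun t => sph lam₂ (hyp t)) (sphDecay lam₂))^[k + 1] g t|
      ≤ D / (lam - 1) ^ 2 * (|lam * (lam - 2) - lam₂ * (lam₂ - 2)| / (lam₂ - 1) ^ 2) ^ (n + 1) :=
  neumann_remainder_le' hlam hlam₂ hg hD n ht

include hlam hlam₂ hg hD in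
/-- **The Neumann series converges uniformly on `(0, ∞)`** on the sharp disc (row 587). -/
theorem neumann_tendstoUniformlyOn (hq : |lam * (lam - 2) - lam₂ * (lam₂ - 2)| < (lam₂ - 1) ^ 2) :
    TendstoUniformlyOn
      (fun n t => ∑ k ∈ Finset.range n, (lam * (lam - 2) - lam₂ * (lam₂ - 2)) ^ k
        * (greenSolI (fun t => sph lam₂ (hyp t)) (sphDecay lam₂))^[k + 1] g t)
      (greenSolI (fun t => sph lam (hyp t)) (sphDecay lam) g) atTop (Ioi 0) :=
  tendstoUniformlyOn_neumann hlam hlam₂ hg hD hq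

end ground_state

end measure

end Summit.Ventures.HodgeRepro2.T5SU11RadialSummaryXXII
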